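import Literature.AlgebraicGeometry.Resolution.QuasiExcellentField
import Literature.AlgebraicGeometry.Resolution.WeakJacobianMizutaniProof
import Literature.AlgebraicGeometry.Resolution.ExcellentRingsFieldProofs
import HarnessLib

/-!
# `CossartPiltant2019` from Thm. 1.1 as printed and the G-ring property of `k[X₁, …, Xₙ]`

Topic: `Literature/AlgebraicGeometry/Resolution`. Proofs only (no new notions, no new named
facts): the root assembly of the named fact `CossartPiltant2019`
(`ResolutionOfSingularities.lean`: every reduced separated scheme of finite type and dimension
`≤ 3` over a field has a resolution) from Cossart–Piltant's Thm. 1.1 in its PRINTED generality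
(`CossartPiltant2019General`, `QuasiExcellentSchemes.lean`: reduced separated Noetherian
quasi-excellent schemes of dimension `≤ 3`), with the excellence input cut down to what the
deduction actually uses.

Cossart–Piltant state Thm. 1.1 for quasi-excellent schemes; the specialisation to schemes of
finite type over a field `k` needs exactly one external input, "schemes locally of finite type
over a field are quasi-excellent" (EGA IV₂ 7.8.3, 7.8.6; Matsumura §32 p. 260). The existing
assembly `CossartPiltant2019General.cossartPiltant2019` (`QuasiExcellentSchemes.lean`) takes it
in the form of the umbrella fact `Stacks07QW_field` (finite type algebras over a field are
EXCELLENT: universally catenary, G-ring and J-2). Since then the J-2 property of finite type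
algebras over a field has been PROVED (`isJ2Ring_of_finiteType_field`, `FieldsJ2.lean` /
`CanonicalResolutionProofs.lean`) and quasi-excellence of such algebras has been reduced to the
single statement that polynomial rings over fields are G-rings (`Matsumura1987_32_polynomial`,
via `isQuasiExcellentRing_of_finiteType_field_of_polynomial` and
`Scheme.isQuasiExcellent_of_locallyOfFiniteType_of_polynomial`, `QuasiExcellentField.lean`);
universal catenarity is not needed at all. Hence:

* `CossartPiltant2019General.resolutionOverUpToDim_of_isQuasiExcellent`,
  `CossartPiltant2019General.cossartPiltant2019_of_isQuasiExcellent` — PROVED: Thm. 1.1 as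
  printed gives `ResolutionOverUpToDim k 3` for every field `k`, i.e. `CossartPiltant2019`, as
  soon as schemes locally of finite type over fields are quasi-excellent (hypothesis `hqe`, by
  whichever route it is eventually proved);
* `CossartPiltant2019General.cossartPiltant2019_of_polynomial` — PROVED:
  `CossartPiltant2019General → Matsumura1987_32_polynomial → CossartPiltant2019`;
* `cossartPiltant2019_of_general_of_polynomial` — PROVED: the same together with the surface
  case `CossartJannsenSaito2020` (which follows from `CossartPiltant2019`,
  `CossartPiltant2019.cossartJannsenSaito2020`), the analogue of `cossartPiltant2019_of_general`.

So the trust base of `CossartPiltant2019` along this line is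
{`CossartPiltant2019General` (CP 2019 Thm. 1.1), `Matsumura1987_32_polynomial` (Matsumura,
proof of Cor. to Thm. 32.6: `k[X₁, …, Xₙ]` is a G-ring)}; the discharge
`CossartPiltant2019_holds` is the one-liner
`CossartPiltant2019General_holds.cossartPiltant2019_of_polynomial Matsumura1987_32_polynomial_holds`
once both inputs are discharged (neither is, as of this file). The alternative line along the
paper's own architecture (Thm. 1.1 ⇐ Prop. 4.4 ⇐ Prop. 4.6 ⇐ Prop. 4.8 ⇐ Thm. 1.4/1.5) is
`cossartPiltant2019_of_local` (`ArithmeticalThreefoldsLocal.lean`).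

NOT here: any new named fact; conclusion (iii) of Thm. 1.1 (strict normal crossings) and the
projectivity complement (not vendored anywhere in this topic); the surface theorem of
Cossart–Jannsen–Saito in printed generality (`CossartJannsenSaito2020General` asks EXCELLENCE,
so its specialisation still goes through `Stacks07QW_field`,
`CossartJannsenSaito2020General.cossartJannsenSaito2020`).

## Sources

* V. Cossart, O. Piltant, *Resolution of singularities of arithmetical threefolds*, J. Algebra
  529 (2019) 268–535 (= arXiv:1412.0868), Thm. 1.1 (p. 3 of the arXiv version: "Let `𝒳` be a
  reduced and separated Noetherian scheme which is quasi-excellent and of dimension at most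
  three. There exists a proper birational morphism `π : 𝒳' → 𝒳` with … (i) `𝒳'` is everywhere
  regular; (ii) `π` induces an isomorphism `π⁻¹(Reg 𝒳) ≃ Reg 𝒳` …"). [CossartPiltant2019]
* H. Matsumura, *Commutative Ring Theory*, CUP 1986, §32 p. 260 (Definition of quasi-excellent;
  Cor. of Thm. 32.6 and its proof). [Matsumura1987]
-/

noncomputable section

open CategoryTheory AlgebraicGeometry

namespace Literature.AlgebraicGeometry.Resolution

universe u

/-- **Thm. 1.1 as printed gives weak resolution up to dimension `3` over a field, given
quasi-excellence of schemes locally of finite type over fields.** A separated `k`-scheme of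
finite type is separated (`Scheme.isSeparated_of_isSeparated_over`) and Noetherian
(`Scheme.isNoetherian_of_finiteType_over_field`); with `hqe` it is quasi-excellent, so
Cossart–Piltant's Thm. 1.1 (`CossartPiltant2019General`) applies, and its conclusion
(`IsResolution π`: proper, birational, regular source) is `Scheme.HasResolution`.
[cite: CossartPiltant2019, Thm. 1.1] -/
theorem CossartPiltant2019General.resolutionOverUpToDim_of_isQuasiExcellent
    (h : CossartPiltant2019General.{u})
    (hqe : ∀ (k : Type u) [Field k] (X : Scheme.{u}) (f : X ⟶ Spec (.of k)),
      LocallyOfFiniteType f → Scheme.IsQuasiExcellent X)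
    (k : Type u) [Field k] : ResolutionOverUpToDim k 3 := by
  intro X f hsep hft hqc hred hdim
  haveI : X.IsSeparated := Scheme.isSeparated_of_isSeparated_over f
  haveI : IsNoetherian X := Scheme.isNoetherian_of_finiteType_over_field f
  obtain ⟨X', π, hπ, -⟩ := h X (hqe k X f hft) (by exact_mod_cast hdim)
  exact ⟨X', π, hπ⟩

/-- **Thm. 1.1 as printed gives `CossartPiltant2019`, given quasi-excellence of schemes locally
of finite type over fields** (by whichever route that input is proved).
[cite: CossartPiltant2019, Thm. 1.1] -/
theorem CossartPiltant2019General.cossartPiltant2019_of_isQuasiExcellent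
    (h : CossartPiltant2019General.{u})
    (hqe : ∀ (k : Type u) [Field k] (X : Scheme.{u}) (f : X ⟶ Spec (.of k)),
      LocallyOfFiniteType f → Scheme.IsQuasiExcellent X) :
    CossartPiltant2019.{u} :=
  cossartPiltant2019_iff.mpr fun k _ => h.resolutionOverUpToDim_of_isQuasiExcellent hqe k

/-- **`CossartPiltant2019General → Matsumura1987_32_polynomial → CossartPiltant2019`**: Thm. 1.1
as printed together with the G-ring property of polynomial rings over fields (the substantial
step of Matsumura's Cor. to Thm. 32.6; the J-2 half of quasi-excellence is the theorem
`isJ2Ring_of_finiteType_field`) gives resolution of reduced separated threefolds of finite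
type over every field — the umbrella excellence fact `Stacks07QW_field` of
`CossartPiltant2019General.cossartPiltant2019` is not needed.
[cite: CossartPiltant2019, Thm. 1.1] -/
theorem CossartPiltant2019General.cossartPiltant2019_of_polynomial
    (h : CossartPiltant2019General.{u}) (hp : Matsumura1987_32_polynomial.{u}) :
    CossartPiltant2019.{u} :=
  h.cossartPiltant2019_of_isQuasiExcellent fun _k _ _X f _hf =>
    Scheme.isQuasiExcellent_of_locallyOfFiniteType_of_polynomial hp f

/-- **Root assembly with the surface case**: CP Thm. 1.1 (printed generality) and the G-ring
property of `k[X₁, …, Xₙ]` give `CossartPiltant2019` and, through it, the surface input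
`CossartJannsenSaito2020` of the patching layer (`CossartPiltant2019.cossartJannsenSaito2020`);
compare `cossartPiltant2019_of_general` (same, from `Stacks07QW_field`).
[cite: CossartPiltant2019, Thm. 1.1] -/
theorem cossartPiltant2019_of_general_of_polynomial (h : CossartPiltant2019General.{u})
    (hp : Matsumura1987_32_polynomial.{u}) :
    CossartPiltant2019.{u} ∧ CossartJannsenSaito2020.{u} :=
  ⟨h.cossartPiltant2019_of_polynomial hp,
    (h.cossartPiltant2019_of_polynomial hp).cossartJannsenSaito2020⟩

/-! ## The auxiliary input is now a theorem: `CossartPiltant2019` from Thm. 1.1 alone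

Update (2026-08-15). Both forms of the external input "schemes locally of finite type over a
field are quasi-excellent" have since been PROVED in the tree:
`Matsumura1987_32_polynomial_holds` (`WeakJacobianMizutaniProof.lean`: `k[X₁, …, Xₙ]` is a
G-ring, Matsumura Thm. 32.6 (Mizutani) and the proof of its Corollary, p. 260) and, from it,
`Stacks07QW_field_holds` (`ExcellentRingsFieldProofs.lean`: finite type algebras over a field are
excellent, Stacks Tag 07QW). Feeding them in, the specialisation of Cossart–Piltant's Thm. 1.1
to schemes of finite type over a field is UNCONDITIONAL: the trust base of `CossartPiltant2019`
along this line is now exactly {`CossartPiltant2019General`} (CP 2019, Thm. 1.1 as printed), and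
the discharge `CossartPiltant2019_holds` is the one-liner
`CossartPiltant2019General_holds.cossartPiltant2019'` once Thm. 1.1 itself is discharged (it is
not: its proof is Chapters 2–9 of the paper together with Cossart–Jannsen–Saito 2020 and
Zariski patching — see the module docstrings of `QuasiExcellentSchemes.lean`,
`ArithmeticalThreefolds.lean`, `ArithmeticalThreefoldsLocal.lean`, `ZariskiPatchingGlue.lean`). -/

/-- **Schemes locally of finite type over a field are quasi-excellent** — the hypothesis `hqe`
of `CossartPiltant2019General.cossartPiltant2019_of_isQuasiExcellent`, PROVED
(`Scheme.isQuasiExcellent_of_locallyOfFiniteType_of_polynomial` fed with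
`Matsumura1987_32_polynomial_holds`). [cite: Matsumura1987, §32 p. 260, Cor. of Thm. 32.6] -/
theorem CossartPiltant2019General.hqe (k : Type u) [Field k] (X : Scheme.{u})
    (f : X ⟶ Spec (.of k)) (hf : LocallyOfFiniteType f) : Scheme.IsQuasiExcellent X :=
  Scheme.isQuasiExcellent_of_locallyOfFiniteType_of_polynomial
    Matsumura1987_32_polynomial_holds f

/-- **Cossart–Piltant Thm. 1.1 as printed implies `CossartPiltant2019`, unconditionally**:
resolution of reduced separated Noetherian quasi-excellent schemes of dimension `≤ 3` gives
resolution of reduced separated schemes of finite type and dimension `≤ 3` over every field,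
the quasi-excellence of the latter being the theorem `CossartPiltant2019General.hqe`.
[cite: CossartPiltant2019, Thm. 1.1] -/
theorem CossartPiltant2019General.cossartPiltant2019' (h : CossartPiltant2019General.{u}) :
    CossartPiltant2019.{u} :=
  h.cossartPiltant2019_of_polynomial Matsumura1987_32_polynomial_holds

/-- The same through the older assembly `CossartPiltant2019General.cossartPiltant2019`
(`QuasiExcellentSchemes.lean`, via the umbrella excellence fact `Stacks07QW_field`, now the
theorem `Stacks07QW_field_holds`); recorded to show the two lines agree.
[cite: CossartPiltant2019, Thm. 1.1] -/
theorem CossartPiltant2019General.cossartPiltant2019'' (h : CossartPiltant2019General.{u}) :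
    CossartPiltant2019.{u} :=
  h.cossartPiltant2019 Stacks07QW_field_holds

/-- **Root assembly with the surface case, unconditionally in the auxiliary input**: Thm. 1.1 as
printed gives `CossartPiltant2019` and, through it, `CossartJannsenSaito2020`
(`cossartPiltant2019_of_general_of_polynomial` fed with `Matsumura1987_32_polynomial_holds`).
[cite: CossartPiltant2019, Thm. 1.1] -/
theorem cossartPiltant2019_of_general' (h : CossartPiltant2019General.{u}) :
    CossartPiltant2019.{u} ∧ CossartJannsenSaito2020.{u} :=
  cossartPiltant2019_of_general_of_polynomial h Matsumura1987_32_polynomial_holds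

/-- **Weak resolution up to dimension `3` over every field from Thm. 1.1 as printed**, in the
applied form used by the patching layer (`ResolutionOverUpToDim`, `ArithmeticalThreefolds.lean`).
[cite: CossartPiltant2019, Thm. 1.1] -/
theorem CossartPiltant2019General.resolutionOverUpToDim_three (h : CossartPiltant2019General.{u})
    (k : Type u) [Field k] : ResolutionOverUpToDim k 3 :=
  h.resolutionOverUpToDim_of_isQuasiExcellent CossartPiltant2019General.hqe k

end Literature.AlgebraicGeometry.Resolution

end
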